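import Summits.Ventures.HodgeKum4.Theorems.KummerFixedLocusL1HilbUnitWords
import HarnessLib

/-!
# Lane (V), line v2p5 — stub S-F (`stub_span`), JOIN half, J1 `UnitReach` part B: the boundary-derivation engine

Cell `hodge-kum4`, crux stmt-Ventures-20306 (`LefschetzGenerationHilb5`, W-form), seam `SF.JoinHalf`
(`Theorems/KummerFixedLocusL1HilbSeam`), cut J1 `UnitReach` (plan g19 `SeamSF.v2.PLAN` e3a3fc3607265de7).
This file = plan g19's scratch `J1UnitReach.partAB` f8d96d9bc959a14f, PART B (engine = `J1BoundaryDerivation`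
952d5374f519ff5f on `uWord`), packaged for the tree by p5 g1 (names and namespace `…L1Hilb.Unit` verbatim; docstrings
added; no statement changed).

For ANY operator `D` on a module `F`, creation operators `q : ℤ → V →ₗ End F` and a unit coefficient `u` with Lehn's
double-commutator rule `hE : [[D, 𝔮ₐ(u)], 𝔮_b(u)] = −ab · 𝔮_{a+b}(u)` (`a, b > 0`; plain commutators), and `D|0⟩ = 0`:
* (B0) `comm_apply_uWord`: `[D, 𝔮ₐ(u)] (U_l v) = U_l ([D, 𝔮ₐ(u)] v) − a • joinSum a l v` (the joined letter stays in
  place); `apply_uWord_vac : D (U_l|0⟩) = junk l − joinAll l` (junk = a prefix of the word applied to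
  `U_suffix (D 𝔮_b(u)|0⟩)`, joins = the `joinSum`s); `joinAll_cons_cons` peels the join of the first two letters;
* (B1) `junk_mem_admSpanGe : junk l ∈ admSpanGe |l|` when every `D(𝔮ₐ(u)|0⟩) ∈ admSpanGe 1`; `joinAll_mem_unitCone`;
* (B2) the two coordinate theorems: `coord_apply_uWord_target` — for `l = s :: t :: l₀` the coordinate of `D(U_l|0⟩)`
  on the index of the joined word `U_{(s+t) :: l₀}|0⟩` (with `|l₀| + 1` parts) is `−(s·t + m)`, `m ∈ ℕ`; and
  `coord_apply_uWord_offColour` — every NON-unit-coloured index with `< |l|` parts gets `0`.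
Intended instance (J1 part C): `D = 𝔡 = 𝔊.boundaryOperator`, `u = 1_S`, `hE` = `ChernCharacterOperators.boundary_bracket`,
`D|0⟩ = 0` = `cupOperator_vacuum`, `D(𝔮ₐ(1)|0⟩) ∈ ℍₐ ⊆ admSpanGe 1` = p2's `range_ofSummand_le_admSpanGe_one`.

Kernel-only, standard axioms, 0 named facts.  HONEST FRAMING: helper lemmas; nothing here asserts J1 ∕ S-F ∕
L1-Hilb(n) ∕ L1 ∕ HC_Kum4Type ∕ HC.
-/

noncomputable section

open DirectSum

universe u v w

namespace Summit.Ventures.HodgeKum4.L1Hilb.Unit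

open Literature.AlgebraicGeometry.HilbertScheme Summit.Ventures.HodgeKum4.L1Hilb.Join

variable {K : Type u} [Field K]
variable {A : ℕ → Type v} [∀ i, AddCommGroup (A i)] [∀ i, Module K (A i)]
variable {Φ : ℕ → ℕ → Type w} [∀ n i, AddCommGroup (Φ n i)] [∀ n i, Module K (Φ n i)]
variable {B : (⨁ i, A i) →ₗ[K] (⨁ i, A i) →ₗ[K] K} {q : ℤ → (⨁ i, A i) →ₗ[K] Module.End K (Fock Φ)} {vac : Fock Φ}
variable {N : ℕ} {x : Fin N → ⨁ i, A i} {deg : Fin N → ℕ}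

/-! ### B0. The boundary-derivation engine (generic `D`, `q`, `u`) -/

section Engine

variable {V : Type v} {F : Type w}

/-- The unit word on a general coefficient type (p2's `Join.unitWord` is stated for `⨁ i, A i`; same definition). -/
def uWord (u : V) (l : List ℕ) : List (ℕ × V) := l.map fun b ↦ (b, u)

/-- `uWord` of the empty list. -/
@[simp] theorem uWord_nil (u : V) : uWord u [] = [] := rfl

/-- `uWord` of a cons. -/
@[simp] theorem uWord_cons (u : V) (b : ℕ) (l : List ℕ) : uWord u (b :: l) = (b, u) :: uWord u l := rfl

/-- `uWord` preserves the length. -/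
@[simp] theorem length_uWord (u : V) (l : List ℕ) : (uWord u l).length = l.length := by simp [uWord]

variable [AddCommGroup V] [Module K V] [AddCommGroup F] [Module K F]

/-- p2's `Join.unitWord` is `uWord` on `⨁ i, A i`. -/
theorem unitWord_eq_uWord (u : ⨁ i, A i) (l : List ℕ) : unitWord u l = uWord u l := rfl

/-- The join sum `Σ_m b_m · 𝔮_{b₁}(u)⋯𝔮_{a+b_m}(u)⋯𝔮_{b_r}(u) v` (the `m`-th letter joined with a part `a`, in place). -/
def joinSum (q : ℤ → V →ₗ[K] Module.End K F) (u : V) (a : ℕ) : List ℕ → F → F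
  | [], _ => 0
  | b :: l, v => (b : K) • q ((a + b : ℕ) : ℤ) u (monomialOp q (uWord u l) v) + q (b : ℤ) u (joinSum q u a l v)

/-- **The commutator `E_a = [D, 𝔮ₐ(u)]` on a unit word.** -/
theorem comm_apply_uWord (q : ℤ → V →ₗ[K] Module.End K F) (D : Module.End K F) (u : V)
    (hE : ∀ a b : ℕ, 0 < a → 0 < b → ∀ x : F,
      (D * q a u - q a u * D) (q b u x) - q b u ((D * q a u - q a u * D) x) = -(((a : K) * b) • q ((a + b : ℕ) : ℤ) u x))
    {a : ℕ} (ha : 0 < a) (l : List ℕ) (hl : ∀ b ∈ l, 0 < b) (v : F) :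
    (D * q a u - q a u * D) (monomialOp q (uWord u l) v) =
      monomialOp q (uWord u l) ((D * q a u - q a u * D) v) - (a : K) • joinSum q u a l v := by
  induction l generalizing v with
  | nil => simp [joinSum]
  | cons b l ih =>
    have hb : 0 < b := hl b List.mem_cons_self
    have ih' := ih (fun b' hb' ↦ hl b' (List.mem_cons_of_mem b hb'))
    have key := hE a b ha hb (monomialOp q (uWord u l) v)
    rw [sub_eq_iff_eq_add'] at key
    rw [uWord_cons, monomialOp_cons, Module.End.mul_apply, key, ih', joinSum, map_sub, map_smul, smul_add,
      smul_smul, Module.End.mul_apply]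
    abel

/-- junk terms: a prefix of the word applied to `U_suffix (D 𝔮_b(u)|0⟩)` -/
def junk (q : ℤ → V →ₗ[K] Module.End K F) (D : Module.End K F) (u : V) (vac : F) : List ℕ → F
  | [] => 0
  | a :: l => q (a : ℤ) u (junk q D u vac l) + monomialOp q (uWord u l) (D (q (a : ℤ) u vac))

/-- all joins: `Σ_{j<m} a_j a_m · U_{l joined at (j,m)} |0⟩` -/
def joinAll (q : ℤ → V →ₗ[K] Module.End K F) (u : V) (vac : F) : List ℕ → F
  | [] => 0
  | a :: l => q (a : ℤ) u (joinAll q u vac l) + (a : K) • joinSum q u a l vac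

/-- **`D (U_l|0⟩) = junk − joins`** (`D|0⟩ = 0`, Lehn's double-commutator rule). -/
theorem apply_uWord_vac (q : ℤ → V →ₗ[K] Module.End K F) (D : Module.End K F) (u : V) {vac : F}
    (hD : D vac = 0)
    (hE : ∀ a b : ℕ, 0 < a → 0 < b → ∀ x : F,
      (D * q a u - q a u * D) (q b u x) - q b u ((D * q a u - q a u * D) x) = -(((a : K) * b) • q ((a + b : ℕ) : ℤ) u x))
    (l : List ℕ) (hl : ∀ b ∈ l, 0 < b) :
    D (monomialOp q (uWord u l) vac) = junk q D u vac l - joinAll q u vac l := by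
  induction l with
  | nil => simp [junk, joinAll, hD]
  | cons a l ih =>
    have ha : 0 < a := hl a List.mem_cons_self
    have hl' : ∀ b ∈ l, 0 < b := fun b hb ↦ hl b (List.mem_cons_of_mem a hb)
    have hcomm := comm_apply_uWord q D u hE ha l hl' vac
    rw [LinearMap.sub_apply, Module.End.mul_apply, Module.End.mul_apply, LinearMap.sub_apply, Module.End.mul_apply,
      Module.End.mul_apply, hD, map_zero, sub_zero, sub_eq_iff_eq_add] at hcomm
    rw [uWord_cons, monomialOp_cons, Module.End.mul_apply, hcomm, ih hl', junk, joinAll, map_sub]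
    abel

/-- Peeling the first two letters: the join of the FIRST TWO letters appears with coefficient `s·t`, the rest is
`𝔮_s(u)(joins of the tail) + s·𝔮_t(u)(joins of s with the others)`. -/
theorem joinAll_cons_cons (q : ℤ → V →ₗ[K] Module.End K F) (u : V) (vac : F) (s t : ℕ) (l₀ : List ℕ) :
    joinAll q u vac (s :: t :: l₀) = ((s : K) * t) • monomialOp q (uWord u ((s + t) :: l₀)) vac +
      (q (s : ℤ) u (joinAll q u vac (t :: l₀)) + (s : K) • q (t : ℤ) u (joinSum q u s l₀ vac)) := by
  simp only [joinAll, joinSum, uWord_cons, monomialOp_cons, Module.End.mul_apply, smul_add, smul_smul]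
  abel

end Engine

/-! ### B1. Junk has at least as many letters; joins lie in the unit cone -/

/-- **Junk keeps the letter count**: if `D(𝔮ₐ(u)|0⟩) ∈ admSpanGe 1` for all `a ≥ 1`, then `junk l ∈ admSpanGe |l|`
(p2's `q_apply_mem_admSpanGe_succ` ∕ `monomialOp_apply_mem_admSpanGe`). -/
theorem junk_mem_admSpanGe (h : IsHeisenbergRepresentation B q vac) (h2 : (2 : K) ≠ 0)
    (hx : ∀ c, x c ∈ LinearMap.range (lof K ℕ A (deg c))) (hsp : Submodule.span K (Set.range x) = ⊤)
    (D : Module.End K (Fock Φ)) (u : ⨁ i, A i) (hD1 : ∀ a : ℕ, 1 ≤ a → D (q (a : ℤ) u vac) ∈ admSpanGe q x vac deg 1)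
    (l : List ℕ) (hl : ∀ b ∈ l, 1 ≤ b) : junk q D u vac l ∈ admSpanGe q x vac deg l.length := by
  induction l with
  | nil => exact Submodule.zero_mem _
  | cons a l ih =>
    have ha : 1 ≤ a := hl a List.mem_cons_self
    have hl' : ∀ b ∈ l, 1 ≤ b := fun b hb ↦ hl b (List.mem_cons_of_mem a hb)
    rw [junk, List.length_cons]
    refine Submodule.add_mem _ (q_apply_mem_admSpanGe_succ h h2 hx hsp (by exact_mod_cast ha) u (ih hl')) ?_
    have := monomialOp_apply_mem_admSpanGe h h2 hx hsp (uWord u l) (fun p hp ↦ ?_) (hD1 a ha)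
    · rw [length_uWord, Nat.add_comm] at this
      exact this
    · obtain ⟨b, hb, rfl⟩ := List.mem_map.1 hp
      exact hl' b hb

/-- The join sums lie in the unit cone. -/
theorem joinSum_mem_unitCone (u : ⨁ i, A i) {a : ℕ} (ha : 1 ≤ a) (l : List ℕ) (hl : ∀ b ∈ l, 1 ≤ b) :
    joinSum q u a l vac ∈ unitCone q vac u := by
  induction l with
  | nil => exact AddSubmonoid.zero_mem _
  | cons b l ih =>
    have hb : 1 ≤ b := hl b List.mem_cons_self
    have hl' : ∀ b ∈ l, 1 ≤ b := fun b hb ↦ hl b (List.mem_cons_of_mem _ hb)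
    rw [joinSum]
    refine AddSubmonoid.add_mem _ (natCast_smul_mem_unitCone u b ?_) (q_apply_mem_unitCone u hb (ih hl'))
    have := q_apply_mem_unitCone (q := q) (vac := vac) u (show 1 ≤ a + b by omega)
      (unitWord_vac_mem_unitCone u hl')
    rwa [unitWord_eq_uWord] at this

/-- All joins lie in the unit cone. -/
theorem joinAll_mem_unitCone (u : ⨁ i, A i) (l : List ℕ) (hl : ∀ b ∈ l, 1 ≤ b) :
    joinAll q u vac l ∈ unitCone q vac u := by
  induction l with
  | nil => exact AddSubmonoid.zero_mem _
  | cons a l ih =>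
    have ha : 1 ≤ a := hl a List.mem_cons_self
    have hl' : ∀ b ∈ l, 1 ≤ b := fun b hb ↦ hl b (List.mem_cons_of_mem _ hb)
    rw [joinAll]
    exact AddSubmonoid.add_mem _ (q_apply_mem_unitCone u ha (ih hl'))
      (natCast_smul_mem_unitCone u a (joinSum_mem_unitCone u ha l hl'))

/-! ### B2. The coordinates of `D(U_l|0⟩)` on the short monomials -/

/-- **(i) The join coefficient.** For `l = s :: t :: l₀` (parts `≥ 1`) and a basis index `ρ'` whose monomial is the
joined word `U_{(s+t) :: l₀}|0⟩` and which has `|l₀| + 1` parts, the `ρ'`-coordinate of `D(U_l|0⟩)` is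
`−(s·t + m)` for a natural number `m` — in particular NON-ZERO in characteristic `0`. -/
theorem coord_apply_uWord_target (h : IsHeisenbergRepresentation B q vac) (h2 : (2 : K) ≠ 0)
    (hx : ∀ c, x c ∈ LinearMap.range (lof K ℕ A (deg c))) (hsp : Submodule.span K (Set.range x) = ⊤) {n : ℕ}
    (Bn : Module.Basis {ρ : Fin N → Fin (n + 1) → ℕ // IsPartitionValued deg n ρ} K (FockSummand Φ n))
    (hBn : ∀ ρ, Fock.ofSummand K Φ n (Bn ρ) = heisenbergMonomial q vac x n ρ.1)
    {c₀ : Fin N} (hc₀ : deg c₀ = 0) (hx₀ : x c₀ ∈ LinearMap.range (lof K ℕ A 0))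
    (D : Module.End K (Fock Φ)) (hD : D vac = 0)
    (hE : ∀ a b : ℕ, 0 < a → 0 < b → ∀ y : Fock Φ,
      (D * q a (x c₀) - q a (x c₀) * D) (q b (x c₀) y) - q b (x c₀) ((D * q a (x c₀) - q a (x c₀) * D) y) =
        -(((a : K) * b) • q ((a + b : ℕ) : ℤ) (x c₀) y))
    (hD1 : ∀ a : ℕ, 1 ≤ a → D (q (a : ℤ) (x c₀) vac) ∈ admSpanGe q x vac deg 1)
    {s t : ℕ} (hs : 1 ≤ s) (ht : 1 ≤ t) (l₀ : List ℕ) (hl₀ : ∀ b ∈ l₀, 1 ≤ b)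
    (ρ' : {ρ : Fin N → Fin (n + 1) → ℕ // IsPartitionValued deg n ρ})
    (hρ' : Fock.ofSummand K Φ n (Bn ρ') = monomialOp q (uWord (x c₀) ((s + t) :: l₀)) vac)
    (hρ'parts : numParts ρ'.1 = l₀.length + 1) :
    ∃ m : ℕ, Bn.coord ρ' (DirectSum.component K ℕ (fun p ↦ FockSummand Φ p) n
      (D (monomialOp q (uWord (x c₀) (s :: t :: l₀)) vac))) = -((s * t + m : ℕ) : K) := by
  classical
  have hl : ∀ b ∈ s :: t :: l₀, 1 ≤ b := by
    intro b hb
    rcases List.mem_cons.1 hb with rfl | hb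
    · exact hs
    rcases List.mem_cons.1 hb with rfl | hb
    · exact ht
    · exact hl₀ b hb
  rw [apply_uWord_vac q D (x c₀) hD hE _ (fun b hb ↦ hl b hb), map_sub, map_sub,
    coord_component_eq_zero_of_mem_admSpanGe h Bn hBn (junk_mem_admSpanGe h h2 hx hsp D (x c₀) hD1 _ hl) ρ'
      (by rw [hρ'parts, List.length_cons, List.length_cons]; omega),
    zero_sub, joinAll_cons_cons, map_add, map_add, map_smul, map_smul, ← hρ', DirectSum.component.lof_self,
    Module.Basis.coord_apply, Bn.repr_self, Finsupp.single_eq_same]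
  -- the rest lies in the unit cone: natural coordinates
  have hrest : q (s : ℤ) (x c₀) (joinAll q (x c₀) vac (t :: l₀)) + (s : K) • q (t : ℤ) (x c₀) (joinSum q (x c₀) s l₀ vac) ∈
      unitCone q vac (x c₀) :=
    AddSubmonoid.add_mem _ (q_apply_mem_unitCone _ hs (joinAll_mem_unitCone _ _ fun b hb ↦ hl b (List.mem_cons_of_mem _ hb)))
      (natCast_smul_mem_unitCone _ s (q_apply_mem_unitCone _ ht (joinSum_mem_unitCone _ hs l₀ hl₀)))
  obtain ⟨m, hm, -⟩ := coord_component_unitCone h Bn hBn hc₀ hx₀ hrest ρ'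
  refine ⟨m, ?_⟩
  rw [hm, smul_eq_mul, mul_one]
  push_cast
  ring

/-- **(ii) Non-unit-coloured short indices get nothing.** For `l` (parts `≥ 1`) and a basis index `ρ''` with
`< |l|` parts that is NOT unit-coloured, the `ρ''`-coordinate of `D(U_l|0⟩)` vanishes. -/
theorem coord_apply_uWord_offColour (h : IsHeisenbergRepresentation B q vac) (h2 : (2 : K) ≠ 0)
    (hx : ∀ c, x c ∈ LinearMap.range (lof K ℕ A (deg c))) (hsp : Submodule.span K (Set.range x) = ⊤) {n : ℕ}
    (Bn : Module.Basis {ρ : Fin N → Fin (n + 1) → ℕ // IsPartitionValued deg n ρ} K (FockSummand Φ n))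
    (hBn : ∀ ρ, Fock.ofSummand K Φ n (Bn ρ) = heisenbergMonomial q vac x n ρ.1)
    {c₀ : Fin N} (hc₀ : deg c₀ = 0) (hx₀ : x c₀ ∈ LinearMap.range (lof K ℕ A 0))
    (D : Module.End K (Fock Φ)) (hD : D vac = 0)
    (hE : ∀ a b : ℕ, 0 < a → 0 < b → ∀ y : Fock Φ,
      (D * q a (x c₀) - q a (x c₀) * D) (q b (x c₀) y) - q b (x c₀) ((D * q a (x c₀) - q a (x c₀) * D) y) =
        -(((a : K) * b) • q ((a + b : ℕ) : ℤ) (x c₀) y))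
    (hD1 : ∀ a : ℕ, 1 ≤ a → D (q (a : ℤ) (x c₀) vac) ∈ admSpanGe q x vac deg 1)
    (l : List ℕ) (hl : ∀ b ∈ l, 1 ≤ b)
    (ρ'' : {ρ : Fin N → Fin (n + 1) → ℕ // IsPartitionValued deg n ρ}) (hparts : numParts ρ''.1 < l.length)
    (hoff : ∃ c, c ≠ c₀ ∧ ∃ r, ρ''.1 c r ≠ 0) :
    Bn.coord ρ'' (DirectSum.component K ℕ (fun p ↦ FockSummand Φ p) n (D (monomialOp q (uWord (x c₀) l) vac))) = 0 := by
  classical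
  rw [apply_uWord_vac q D (x c₀) hD hE _ (fun b hb ↦ hl b hb), map_sub, map_sub,
    coord_component_eq_zero_of_mem_admSpanGe h Bn hBn (junk_mem_admSpanGe h h2 hx hsp D (x c₀) hD1 _ hl) ρ'' hparts,
    zero_sub, neg_eq_zero]
  obtain ⟨m, hm, hm0⟩ := coord_component_unitCone h Bn hBn hc₀ hx₀ (joinAll_mem_unitCone (x c₀) l hl) ρ''
  rw [hm, hm0 hoff, Nat.cast_zero]

end Summit.Ventures.HodgeKum4.L1Hilb.Unit

end
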